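import Mathlib
import HarnessLib
import Summits.Ventures.LatticeQCDFlow.Exactness.NCMCGeneralSpaceErgodicRun

/-!
# Independent evolutions are the special case: an i.i.d. run is a stationary ergodic stream

HONEST FRAMING: exact (Metropolis-corrected) sampling algorithms for lattice gauge theory;
figures of merit are autocorrelation/cost numbers at stated couplings and volumes; no
continuum-physics claim.

Venture `LatticeQCDFlow` (cell pub-lqcd), topic `Exactness`; FANOUT row 13 (`eng-snf`, GEN-16).
NEW WORK of the cell, not a published result; no definition is introduced; nothing is cited as a
fact (Kolmogorov's zero–one law is Mathlib's `measure_zero_or_one_of_measurableSet_limsup_atTop`;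
"the Bernoulli shift is ergodic" — e.g. Walters, *An Introduction to Ergodic Theory*, Thm 1.12 — is
named only and PROVED here for the one-sided shift on `ℕ → E` with an arbitrary factor law).
Companion of `NCMCGeneralSpaceErgodicRun.lean` / `NCMCGeneralSpaceStationaryRun.lean`: those files
assume a STATIONARY (resp. ERGODIC) stream of evolution records; this file shows that the law of
GEN-11–GEN-15's independent runs, `Measure.infinitePi (fun _ : ℕ ↦ μ)`, is both — so every
"correlated starts" theorem specialises to (and re-proves the strong-law half of) the independent
case, and the two families of files are consistent.

## Content

* **`map_shift_infinitePi`**, `measurePreserving_shift_infinitePi` — the i.i.d. law is invariant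
  under the shift (Mathlib's `Measure.map_infinitePi_infinitePi_of_inj` with the injection
  `k ↦ k + 1`).
* `preimage_shift_iterate_eq`, `comap_shift_iterate_le` — a strictly shift-invariant set is
  invariant under every iterate, and the `n`-th iterate of the shift is measurable from the
  σ-algebra of the coordinates `≥ n`; **`measurableSet_tail_of_shift_invariant`** — hence a
  shift-invariant measurable set is a TAIL event.
* **`ergodic_shift_infinitePi`** — KOLMOGOROV ⇒ ERGODIC: the one-sided Bernoulli shift over any
  probability law `μ` on any measurable space is ergodic (the coordinates are independent under
  `infinitePi`, Mathlib `iIndepFun_infinitePi`; a tail event has probability `0` or `1`).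
* **`tendsto_sum_div_ae_infinitePi`** — the strong law for an i.i.d. run RE-DERIVED from Birkhoff's
  theorem through `tendsto_sum_div_ae_of_ergodic` (hypothesis: `φ ∈ L¹(μ)` only; GEN-11's
  `tendsto_sampleMean_ae` used Etemadi's pairwise strong law and asked `φ` measurable).

NOT CLAIMED: anything new about the engine — this is the consistency check of the framework; the
two-sided (`ℤ`-indexed) shift; mixing.
-/

namespace Summit.Ventures.LatticeQCDFlow.Exactness.GeneralNCMC

open MeasureTheory ProbabilityTheory Set Filter Finset
open scoped ENNReal Topology

variable {E : Type*} [MeasurableSpace E]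

/-! ## The i.i.d. law is shift-invariant -/

/-- **`Measure.infinitePi (fun _ ↦ μ)` is invariant under the shift.** -/
theorem map_shift_infinitePi (μ : Measure E) [IsProbabilityMeasure μ] :
    (Measure.infinitePi fun _ : ℕ => μ).map (fun (ω : ℕ → E) (k : ℕ) => ω (k + 1)) =
      Measure.infinitePi fun _ : ℕ => μ :=
  Measure.map_infinitePi_infinitePi_of_inj (P := fun _ : ℕ => μ) (f := fun k : ℕ => k + 1)
    (add_left_injective 1)

/-- The shift preserves the i.i.d. law. -/
theorem measurePreserving_shift_infinitePi (μ : Measure E) [IsProbabilityMeasure μ] :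
    MeasurePreserving (fun (ω : ℕ → E) (k : ℕ) => ω (k + 1))
      (Measure.infinitePi fun _ : ℕ => μ) (Measure.infinitePi fun _ : ℕ => μ) :=
  ⟨measurable_shift, map_shift_infinitePi μ⟩

/-! ## Shift-invariant sets are tail events -/

omit [MeasurableSpace E] in
/-- A strictly shift-invariant set is invariant under every iterate of the shift. -/
theorem preimage_shift_iterate_eq {S : Set (ℕ → E)}
    (hinv : (fun (ω : ℕ → E) (k : ℕ) => ω (k + 1)) ⁻¹' S = S) (n : ℕ) :
    (fun (ω : ℕ → E) (k : ℕ) => ω (k + 1))^[n] ⁻¹' S = S := by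
  induction n with
  | zero => rfl
  | succ n ih => rw [Function.iterate_succ, Set.preimage_comp, ih, hinv]

/-- The pull-back of the product σ-algebra under the `n`-th iterate of the shift is contained in
the σ-algebra generated by the coordinates `i ≥ n`. -/
theorem comap_shift_iterate_le (n : ℕ) :
    MeasurableSpace.comap ((fun (ω : ℕ → E) (k : ℕ) => ω (k + 1))^[n])
        (MeasurableSpace.pi : MeasurableSpace (ℕ → E)) ≤
      ⨆ i ≥ n, MeasurableSpace.comap (fun ω : ℕ → E => ω i) inferInstance := by
  rw [show (MeasurableSpace.pi : MeasurableSpace (ℕ → E)) =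
      ⨆ a : ℕ, MeasurableSpace.comap (fun ω : ℕ → E => ω a) inferInstance from rfl,
    MeasurableSpace.comap_iSup, iSup_le_iff]
  intro a
  rw [MeasurableSpace.comap_comp]
  have hfun : (fun ω : ℕ → E => ω a) ∘ ((fun (ω : ℕ → E) (k : ℕ) => ω (k + 1))^[n]) =
      fun ω => ω (a + n) := by
    funext ω
    exact shift_iterate_apply ω n a
  rw [hfun]
  exact le_iSup₂ (f := fun (i : ℕ) (_ : i ≥ n) =>
    MeasurableSpace.comap (fun ω : ℕ → E => ω i) inferInstance) (a + n) (Nat.le_add_left n a)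

/-- **A shift-invariant measurable set is a tail event** (measurable for
`limsup_n σ(ω_n) = ⋂_n σ(ω_i : i ≥ n)`). -/
theorem measurableSet_tail_of_shift_invariant {S : Set (ℕ → E)} (hS : MeasurableSet S)
    (hinv : (fun (ω : ℕ → E) (k : ℕ) => ω (k + 1)) ⁻¹' S = S) :
    MeasurableSet[limsup (fun n : ℕ => MeasurableSpace.comap (fun ω : ℕ → E => ω n) inferInstance)
      atTop] S := by
  rw [limsup_eq_iInf_iSup_of_nat]
  refine MeasurableSpace.measurableSet_iInf.2 fun n => comap_shift_iterate_le n _ ?_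
  rw [MeasurableSpace.measurableSet_comap]
  exact ⟨S, hS, preimage_shift_iterate_eq hinv n⟩

/-! ## Kolmogorov ⇒ the Bernoulli shift is ergodic -/

/-- **The i.i.d. law is ergodic for the shift**: every strictly shift-invariant measurable set of
streams has probability `0` or `1` under `Measure.infinitePi (fun _ ↦ μ)` (it is a tail event of the
independent coordinates — Kolmogorov's zero–one law), and the shift preserves the law. -/
theorem ergodic_shift_infinitePi (μ : Measure E) [IsProbabilityMeasure μ] :
    Ergodic (fun (ω : ℕ → E) (k : ℕ) => ω (k + 1)) (Measure.infinitePi fun _ : ℕ => μ) := by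
  refine ⟨measurePreserving_shift_infinitePi μ, ⟨fun S hS hinv => ?_⟩⟩
  have hm_le : ∀ n : ℕ, MeasurableSpace.comap (fun ω : ℕ → E => ω n) inferInstance ≤
      (MeasurableSpace.pi : MeasurableSpace (ℕ → E)) := fun n => (measurable_pi_apply n).comap_le
  have hind : iIndep (fun n : ℕ => MeasurableSpace.comap (fun ω : ℕ → E => ω n) inferInstance)
      (Measure.infinitePi fun _ : ℕ => μ) :=
    (iIndepFun_infinitePi (P := fun _ : ℕ => μ) (X := fun (_ : ℕ) (x : E) => x)
      fun _ => measurable_id).iIndep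
  have h01 := measure_zero_or_one_of_measurableSet_limsup_atTop hm_le hind
    (measurableSet_tail_of_shift_invariant hS hinv)
  rw [eventuallyConst_set]
  rcases h01 with h0 | h1
  · exact Or.inr (measure_eq_zero_iff_ae_notMem.1 h0)
  · exact Or.inl (mem_ae_iff.2 ((prob_compl_eq_zero_iff hS).2 h1))

/-! ## The strong law of an i.i.d. run, from Birkhoff -/

/-- **The strong law for an i.i.d. run, re-derived from the ergodic theorem**: for `φ ∈ L¹(μ)`,
`(1/n) Σ_{i<n} φ(ω i) → E_μ φ` for `infinitePi`-almost every run (GEN-11's `tendsto_sampleMean_ae`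
via Etemadi; here via `ergodic_shift_infinitePi` + Birkhoff, with no measurability hypothesis). -/
theorem tendsto_sum_div_ae_infinitePi (μ : Measure E) [IsProbabilityMeasure μ] {φ : E → ℝ}
    (hφ : Integrable φ μ) :
    ∀ᵐ ω ∂(Measure.infinitePi fun _ : ℕ => μ),
      Tendsto (fun n : ℕ => (∑ i ∈ range n, φ (ω i)) / n) atTop (𝓝 (∫ a, φ a ∂μ)) :=
  tendsto_sum_div_ae_of_ergodic (ergodic_shift_infinitePi μ) (Measure.infinitePi_map_eval _ 0) hφ

end Summit.Ventures.LatticeQCDFlow.Exactness.GeneralNCMC
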